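import Mathlib

/-!
# The maximal parabolic subgroups `P^a_c` of `GL_a(F)`: frame fixer, Levi block, cardinality

Supports stmt-MatrixMultiplication-14079 (route `LevelGradedCohnUmans`, crux `SubgroupIdentityDesigns`).
VALUE = theorem (infrastructure for the hook unipotent character `χ^{(l,1^k)}` that closes the
block-slice corner of `BlockSliceSummary` for all primes), NOT summit progress.

For a finite field `F`, `G_a = GL_a(F)` and `c ≤ a`:
* `parab F a c` — the standard maximal parabolic `P^a_c = {g | g_{st} = 0 for t < c ≤ s}` (the
  stabiliser of `V_c = ⟨e_0, …, e_{c-1}⟩`); `fixer F a c` — `Q^a_c = {g | g e_t = e_t, t < c}`, the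
  pointwise stabiliser of the standard `c`-frame (`Q^a_c ⊴ P^a_c`, the kernel of `ul`);
* `ul hc : P^a_c →* GL_c(F)` — the upper-left `c × c` block (the `GL_c`-part of the Levi quotient),
  `lift hc : GL_c(F) →* GL_a(F)` — `x ↦ diag(x, 1)`, a section of `ul` (`ul_lift`, `ul_surjective`);
* `ul_eq_one_iff`, `ker_ul_eq` — the kernel of `ul` is `Q^a_c`;
* `card_parab` — **`|P^a_c| = |Q^a_c| · |GL_c(F)|`**; `parab_self_eq_top`, `fixer_self_eq_bot`, `ul_self`.
Generic helpers: `inv_mem_of_mul_closed` (a multiplicatively closed subset of a finite group is a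
subgroup), `sum_comp_eq_card_ker_mul` (`∑_{q} F(π q) = |ker π| ∑_y F(y)` for a surjective
homomorphism), `card_comap_eq`, `sum_eq_sum_castLE`.
(Standard facts on parabolic subgroups of `GL_n(𝔽_q)`: Digne–Michel, *Representations of Finite
Groups of Lie Type*, Ch. 1–2; Zelevinsky, LNM 869, §9.)
-/

set_option linter.dupNamespace false

noncomputable section

open scoped BigOperators Matrix Classical

namespace Summit.MatrixMultiplication.MatrixMultiplication.Theorems.SubgroupIdentityDesigns.Negative
namespace ParabolicSubgroup

/-! ## Generic helpers -/

/-- In a finite group a multiplicatively closed subset containing `1` is closed under inverses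
(`g⁻¹ = g^{ord g - 1}`). -/
theorem inv_mem_of_mul_closed {G : Type} [Group G] [Finite G] {S : Set G} (h1 : (1 : G) ∈ S)
    (hmul : ∀ {x y : G}, x ∈ S → y ∈ S → x * y ∈ S) {g : G} (hg : g ∈ S) : g⁻¹ ∈ S := by
  have hpow : ∀ n : ℕ, g ^ n ∈ S := fun n => by
    induction n with
    | zero => simpa using h1
    | succ n ih => rw [pow_succ]; exact hmul ih hg
  have hord : 0 < orderOf g := orderOf_pos_iff.mpr (isOfFinOrder_of_finite g)
  have hinv : g⁻¹ = g ^ (orderOf g - 1) := by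
    refine inv_eq_of_mul_eq_one_right ?_
    rw [← pow_succ', Nat.sub_add_cancel hord, pow_orderOf_eq_one]
  rw [hinv]
  exact hpow _

/-- Summing `F ∘ π` over the source of a surjective homomorphism of finite groups:
`∑_{q ∈ P} F(π q) = |ker π| · ∑_{y ∈ L} F(y)`. -/
theorem sum_comp_eq_card_ker_mul {P L : Type} [Group P] [Group L] [Fintype P] [Fintype L]
    [DecidableEq L] (π : P →* L) (hπ : Function.Surjective π) (f : L → ℂ) :
    ∑ q : P, f (π q) = (Nat.card π.ker : ℂ) * ∑ y : L, f y := by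
  rw [Finset.mul_sum]
  rw [← Finset.sum_fiberwise_of_maps_to (g := fun q : P => π q) (t := Finset.univ)
    (fun q _ => Finset.mem_univ _)]
  refine Finset.sum_congr rfl fun y _ => ?_
  have hconst : ∀ q ∈ Finset.univ.filter (fun q : P => π q = y), f (π q) = f y := fun q hq => by
    rw [(Finset.mem_filter.mp hq).2]
  rw [Finset.sum_congr rfl hconst, Finset.sum_const, nsmul_eq_mul]
  congr 1
  -- the fibre over `y` is a coset of the kernel
  obtain ⟨q₀, hq₀⟩ := hπ y
  have hbij : (Finset.univ.filter (fun q : P => π q = y)).card = Fintype.card π.ker := by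
    refine Finset.card_bij (fun q _ => (⟨q₀⁻¹ * q, ?_⟩ : π.ker)) (fun _ _ => Finset.mem_univ _)
      ?_ ?_
    · rename_i hq
      rw [MonoidHom.mem_ker, map_mul, map_inv, hq₀, (Finset.mem_filter.mp hq).2, inv_mul_cancel]
    · intro q₁ hq₁ q₂ hq₂ h
      have := congrArg Subtype.val h
      simpa using this
    · intro z _
      refine ⟨q₀ * z, Finset.mem_filter.mpr ⟨Finset.mem_univ _, ?_⟩, ?_⟩
      · rw [map_mul, hq₀, (MonoidHom.mem_ker).mp z.2, mul_one]
      · exact Subtype.ext (by simp)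
  rw [hbij, Nat.card_eq_fintype_card]

/-- The preimage of a subgroup under a surjective homomorphism: `|π⁻¹ H| = |ker π| · |H|`. -/
theorem card_comap_eq {P L : Type} [Group P] [Group L] [Fintype P] [Fintype L] [DecidableEq L]
    [DecidableEq P] (π : P →* L) (hπ : Function.Surjective π) (H : Subgroup L)
    [DecidablePred (· ∈ H)] :
    (Nat.card (H.comap π) : ℂ) = Nat.card π.ker * Nat.card H := by
  classical
  have h1 : (Nat.card (H.comap π) : ℂ) = ∑ q : P, (if π q ∈ H then (1 : ℂ) else 0) := by
    rw [Finset.sum_boole, Nat.card_eq_fintype_card]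
    congr 1
    refine (Fintype.card_of_subtype _ fun q => ?_)
    simp [Subgroup.mem_comap]
  have h2 : (Nat.card H : ℂ) = ∑ y : L, (if y ∈ H then (1 : ℂ) else 0) := by
    rw [Finset.sum_boole, Nat.card_eq_fintype_card]
    congr 1
    exact Fintype.card_of_subtype _ fun y => by simp
  rw [h1, h2, sum_comp_eq_card_ker_mul π hπ (fun y => if y ∈ H then (1 : ℂ) else 0)]

variable {F : Type} [Field F] [Fintype F] [DecidableEq F] {a c : ℕ}

/-- Sums over `Fin a` of functions vanishing on indices `≥ c` are sums over `Fin c` (via `Fin.castLE`). -/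
theorem sum_eq_sum_castLE {M : Type} [AddCommMonoid M] (hc : c ≤ a) (f : Fin a → M)
    (hf : ∀ u : Fin a, c ≤ (u : ℕ) → f u = 0) :
    ∑ u, f u = ∑ u : Fin c, f (Fin.castLE hc u) := by
  have hsub : (Finset.univ.map (Fin.castLEEmb hc)) ⊆ (Finset.univ : Finset (Fin a)) :=
    Finset.subset_univ _
  rw [← Finset.sum_subset hsub]
  · rw [Finset.sum_map]
    rfl
  · intro u _ hu
    apply hf
    by_contra h
    push Not at h
    exact hu (Finset.mem_map.mpr ⟨⟨u, h⟩, Finset.mem_univ _, Fin.ext rfl⟩)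

/-! ## The maximal parabolic `P^a_c` and the frame fixer `Q^a_c` -/

/-- `P^a_c` as a submonoid: block upper triangular matrices, `g_{st} = 0` for `t < c ≤ s`. -/
def parabMon (F : Type) [Field F] [Fintype F] [DecidableEq F] (a c : ℕ) :
    Submonoid (GL (Fin a) F) where
  carrier := {g | ∀ s t : Fin a, (t : ℕ) < c → c ≤ (s : ℕ) → (g : Matrix (Fin a) (Fin a) F) s t = 0}
  one_mem' := by
    intro s t ht hs
    rw [Units.val_one, Matrix.one_apply, if_neg]
    rintro rfl
    omega
  mul_mem' := by
    intro g h hg hh s t ht hs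
    rw [Units.val_mul, Matrix.mul_apply]
    refine Finset.sum_eq_zero fun u _ => ?_
    by_cases hu : (u : ℕ) < c
    · rw [hg s u hu hs, zero_mul]
    · rw [hh u t ht (by omega), mul_zero]

/-- **`P^a_c`**, the standard maximal parabolic subgroup of `GL_a(F)` (stabiliser of
`⟨e_0, …, e_{c-1}⟩`). -/
def parab (F : Type) [Field F] [Fintype F] [DecidableEq F] (a c : ℕ) : Subgroup (GL (Fin a) F) :=
  { parabMon F a c with
    inv_mem' := fun hg => inv_mem_of_mul_closed (parabMon F a c).one_mem
      (fun hx hy => (parabMon F a c).mul_mem hx hy) hg }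

/-- Membership in `P^a_c`. -/
theorem mem_parab {g : GL (Fin a) F} :
    g ∈ parab F a c ↔ ∀ s t : Fin a, (t : ℕ) < c → c ≤ (s : ℕ) →
      (g : Matrix (Fin a) (Fin a) F) s t = 0 := Iff.rfl

/-- `Q^a_c` as a submonoid: the first `c` columns are those of the identity. -/
def fixerMon (F : Type) [Field F] [Fintype F] [DecidableEq F] (a c : ℕ) :
    Submonoid (GL (Fin a) F) where
  carrier := {g | ∀ s t : Fin a, (t : ℕ) < c →
    (g : Matrix (Fin a) (Fin a) F) s t = if s = t then 1 else 0}
  one_mem' := fun s t _ => by rw [Units.val_one, Matrix.one_apply]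
  mul_mem' := by
    intro g h hg hh s t ht
    rw [Units.val_mul, Matrix.mul_apply, Finset.sum_eq_single t]
    · rw [hh t t ht, if_pos rfl, mul_one, hg s t ht]
    · intro u _ hut
      rw [hh u t ht, if_neg hut, mul_zero]
    · intro h'
      exact absurd (Finset.mem_univ t) h'

/-- **`Q^a_c`**, the pointwise stabiliser of the standard `c`-frame `e_0, …, e_{c-1}`. -/
def fixer (F : Type) [Field F] [Fintype F] [DecidableEq F] (a c : ℕ) : Subgroup (GL (Fin a) F) :=
  { fixerMon F a c with
    inv_mem' := fun hg => inv_mem_of_mul_closed (fixerMon F a c).one_mem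
      (fun hx hy => (fixerMon F a c).mul_mem hx hy) hg }

/-- Membership in `Q^a_c`. -/
theorem mem_fixer {g : GL (Fin a) F} :
    g ∈ fixer F a c ↔ ∀ s t : Fin a, (t : ℕ) < c →
      (g : Matrix (Fin a) (Fin a) F) s t = if s = t then 1 else 0 := Iff.rfl

/-- `Q^a_c ≤ P^a_c`. -/
theorem fixer_le_parab : fixer F a c ≤ parab F a c := by
  intro g hg s t ht hs
  rw [mem_fixer.mp hg s t ht, if_neg]
  rintro rfl
  omega

/-! ## The upper-left block `ul : P^a_c →* GL_c(F)` and its section `lift` -/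

/-- The upper-left `c × c` block of an `a × a` matrix (`c ≤ a`). -/
def ulMat (hc : c ≤ a) (g : Matrix (Fin a) (Fin a) F) : Matrix (Fin c) (Fin c) F :=
  fun s t => g (Fin.castLE hc s) (Fin.castLE hc t)

omit [Fintype F] [DecidableEq F] in
/-- `ulMat` of the identity. -/
theorem ulMat_one (hc : c ≤ a) : ulMat hc (1 : Matrix (Fin a) (Fin a) F) = 1 := by
  ext s t
  simp only [ulMat, Matrix.one_apply, (Fin.castLE_injective hc).eq_iff]

omit [Fintype F] [DecidableEq F] in
/-- `ulMat` is multiplicative against block upper triangular matrices on the right. -/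
theorem ulMat_mul (hc : c ≤ a) (g h : Matrix (Fin a) (Fin a) F)
    (hh : ∀ s t : Fin a, (t : ℕ) < c → c ≤ (s : ℕ) → h s t = 0) :
    ulMat hc (g * h) = ulMat hc g * ulMat hc h := by
  ext s t
  simp only [ulMat, Matrix.mul_apply]
  exact sum_eq_sum_castLE hc _ fun u hu => by
    rw [hh u (Fin.castLE hc t) (show ((Fin.castLE hc t : Fin a) : ℕ) < c from t.2) hu, mul_zero]

/-- `ulMat g · ulMat g⁻¹ = 1` for `g ∈ P^a_c`. -/
theorem ulMat_mul_inv (hc : c ≤ a) (g : parab F a c) :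
    ulMat hc ((g : GL (Fin a) F) : Matrix (Fin a) (Fin a) F) *
      ulMat hc (((g : GL (Fin a) F)⁻¹ : GL (Fin a) F) : Matrix (Fin a) (Fin a) F) = 1 := by
  have h := ulMat_mul hc ((g : GL (Fin a) F) : Matrix (Fin a) (Fin a) F)
    (((g : GL (Fin a) F)⁻¹ : GL (Fin a) F) : Matrix (Fin a) (Fin a) F) (mem_parab.mp (inv_mem g.2))
  rw [← Units.val_mul, mul_inv_cancel, Units.val_one, ulMat_one] at h
  exact h.symm

/-- `ulMat g⁻¹ · ulMat g = 1` for `g ∈ P^a_c`. -/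
theorem ulMat_inv_mul (hc : c ≤ a) (g : parab F a c) :
    ulMat hc (((g : GL (Fin a) F)⁻¹ : GL (Fin a) F) : Matrix (Fin a) (Fin a) F) *
      ulMat hc ((g : GL (Fin a) F) : Matrix (Fin a) (Fin a) F) = 1 := by
  have h := ulMat_mul hc (((g : GL (Fin a) F)⁻¹ : GL (Fin a) F) : Matrix (Fin a) (Fin a) F)
    ((g : GL (Fin a) F) : Matrix (Fin a) (Fin a) F) (mem_parab.mp g.2)
  rw [← Units.val_mul, inv_mul_cancel, Units.val_one, ulMat_one] at h
  exact h.symm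

/-- **`ul`**: the upper-left block as a homomorphism `P^a_c →* GL_c(F)`. -/
def ul (hc : c ≤ a) : parab F a c →* GL (Fin c) F where
  toFun g :=
    ⟨ulMat hc ((g : GL (Fin a) F) : Matrix (Fin a) (Fin a) F),
     ulMat hc (((g : GL (Fin a) F)⁻¹ : GL (Fin a) F) : Matrix (Fin a) (Fin a) F),
     ulMat_mul_inv hc g, ulMat_inv_mul hc g⟩
  map_one' := Units.ext (by simp only [OneMemClass.coe_one, Units.val_one, ulMat_one])
  map_mul' g h := Units.ext (by
    simp only [Subgroup.coe_mul, Units.val_mul]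
    exact ulMat_mul hc _ _ (mem_parab.mp h.2))

/-- Entries of `ul g`. -/
theorem ul_apply (hc : c ≤ a) (g : parab F a c) (s t : Fin c) :
    ((ul hc g : GL (Fin c) F) : Matrix (Fin c) (Fin c) F) s t =
      ((g : GL (Fin a) F) : Matrix (Fin a) (Fin a) F) (Fin.castLE hc s) (Fin.castLE hc t) := rfl

/-- The block diagonal matrix `diag(x, 1)`. -/
def liftMat (_hc : c ≤ a) (x : Matrix (Fin c) (Fin c) F) : Matrix (Fin a) (Fin a) F :=
  fun s t => if hs : (s : ℕ) < c then (if ht : (t : ℕ) < c then x ⟨s, hs⟩ ⟨t, ht⟩ else 0)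
    else (if s = t then 1 else 0)

omit [Fintype F] [DecidableEq F] in
/-- `liftMat 1 = 1`. -/
theorem liftMat_one (hc : c ≤ a) : liftMat hc (1 : Matrix (Fin c) (Fin c) F) = 1 := by
  ext s t
  simp only [liftMat, Matrix.one_apply]
  by_cases hs : (s : ℕ) < c
  · rw [dif_pos hs]
    by_cases ht : (t : ℕ) < c
    · rw [dif_pos ht]
      simp only [Fin.ext_iff]
    · rw [dif_neg ht, if_neg]
      rintro rfl
      exact ht hs
  · rw [dif_neg hs]

omit [Fintype F] [DecidableEq F] in
/-- `liftMat` is multiplicative. -/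
theorem liftMat_mul (hc : c ≤ a) (x y : Matrix (Fin c) (Fin c) F) :
    liftMat hc (x * y) = liftMat hc x * liftMat hc y := by
  ext s t
  rw [Matrix.mul_apply]
  by_cases hs : (s : ℕ) < c
  · -- row in the `GL_c` block
    have hrow : ∀ u : Fin a, liftMat hc x s u = if hu : (u : ℕ) < c then x ⟨s, hs⟩ ⟨u, hu⟩ else 0 :=
      fun u => by simp only [liftMat, dif_pos hs]
    by_cases ht : (t : ℕ) < c
    · have hl : liftMat hc (x * y) s t = ∑ u : Fin c, x ⟨s, hs⟩ u * y u ⟨t, ht⟩ := by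
        simp only [liftMat, dif_pos hs, dif_pos ht, Matrix.mul_apply]
      rw [hl, sum_eq_sum_castLE hc (fun u => liftMat hc x s u * liftMat hc y u t)]
      · refine Finset.sum_congr rfl fun u _ => ?_
        have h1 : liftMat hc x s (Fin.castLE hc u) = x ⟨s, hs⟩ u := by
          rw [hrow, dif_pos (show ((Fin.castLE hc u : Fin a) : ℕ) < c from u.2)]
          exact congrArg _ (Fin.ext rfl)
        have h2 : liftMat hc y (Fin.castLE hc u) t = y u ⟨t, ht⟩ := by
          simp only [liftMat, dif_pos (show ((Fin.castLE hc u : Fin a) : ℕ) < c from u.2), dif_pos ht]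
          rfl
        rw [h1, h2]
      · intro u hu
        rw [hrow, dif_neg (by omega), zero_mul]
    · have hl : liftMat hc (x * y) s t = 0 := by simp only [liftMat, dif_pos hs, dif_neg ht]
      rw [hl]
      refine (Finset.sum_eq_zero fun u _ => ?_).symm
      by_cases hu : (u : ℕ) < c
      · have : liftMat hc y u t = 0 := by simp only [liftMat, dif_pos hu, dif_neg ht]
        rw [this, mul_zero]
      · rw [hrow, dif_neg hu, zero_mul]
  · -- row in the identity block
    have hrow : ∀ u : Fin a, liftMat hc x s u = if s = u then 1 else 0 := fun u => by
      simp only [liftMat, dif_neg hs]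
    have hl : liftMat hc (x * y) s t = if s = t then 1 else 0 := by simp only [liftMat, dif_neg hs]
    rw [hl, Finset.sum_eq_single s]
    · rw [hrow, if_pos rfl, one_mul]
      simp only [liftMat, dif_neg hs]
    · intro u _ hus
      rw [hrow, if_neg (Ne.symm hus), zero_mul]
    · intro h
      exact absurd (Finset.mem_univ s) h

/-- `liftMat` as a monoid homomorphism of matrix rings. -/
def liftMatHom (hc : c ≤ a) : Matrix (Fin c) (Fin c) F →* Matrix (Fin a) (Fin a) F where
  toFun := liftMat hc
  map_one' := liftMat_one hc
  map_mul' := liftMat_mul hc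

/-- **`lift`**: `x ↦ diag(x, 1)`, `GL_c(F) →* GL_a(F)`. -/
def lift (hc : c ≤ a) : GL (Fin c) F →* GL (Fin a) F := Units.map (liftMatHom hc)

omit [Fintype F] [DecidableEq F] in
/-- Entries of `lift x`. -/
theorem lift_apply (hc : c ≤ a) (x : GL (Fin c) F) (s t : Fin a) :
    ((lift hc x : GL (Fin a) F) : Matrix (Fin a) (Fin a) F) s t =
      if hs : (s : ℕ) < c then (if ht : (t : ℕ) < c then (x : Matrix (Fin c) (Fin c) F) ⟨s, hs⟩ ⟨t, ht⟩
        else 0) else (if s = t then 1 else 0) := rfl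

/-- `lift x ∈ P^a_c`. -/
theorem lift_mem_parab (hc : c ≤ a) (x : GL (Fin c) F) : lift hc x ∈ parab F a c := by
  intro s t ht hs
  rw [lift_apply, dif_neg (by omega), if_neg]
  rintro rfl
  omega

/-- `ul (lift x) = x`. -/
theorem ul_lift (hc : c ≤ a) (x : GL (Fin c) F) : ul hc ⟨lift hc x, lift_mem_parab hc x⟩ = x := by
  refine Units.ext (Matrix.ext fun s t => ?_)
  rw [ul_apply]
  show ((lift hc x : GL (Fin a) F) : Matrix (Fin a) (Fin a) F) (Fin.castLE hc s) (Fin.castLE hc t) = _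
  rw [lift_apply, dif_pos (show ((Fin.castLE hc s : Fin a) : ℕ) < c from s.2),
    dif_pos (show ((Fin.castLE hc t : Fin a) : ℕ) < c from t.2)]
  rfl

/-- `ul` is surjective. -/
theorem ul_surjective (hc : c ≤ a) : Function.Surjective (ul (F := F) hc) :=
  fun x => ⟨⟨lift hc x, lift_mem_parab hc x⟩, ul_lift hc x⟩

/-- **The kernel of `ul` is `Q^a_c`**: for `g ∈ P^a_c`, `ul g = 1 ↔ g ∈ Q^a_c`. -/
theorem ul_eq_one_iff (hc : c ≤ a) (g : parab F a c) : ul hc g = 1 ↔ (g : GL (Fin a) F) ∈ fixer F a c := by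
  constructor
  · intro h s t ht
    by_cases hs : (s : ℕ) < c
    · have h' := congrArg (fun u : GL (Fin c) F => (u : Matrix (Fin c) (Fin c) F) ⟨s, hs⟩ ⟨t, ht⟩) h
      simp only [ul_apply, Units.val_one, Matrix.one_apply, Fin.mk.injEq] at h'
      have e1 : Fin.castLE hc ⟨s, hs⟩ = s := Fin.ext rfl
      have e2 : Fin.castLE hc ⟨t, ht⟩ = t := Fin.ext rfl
      rw [e1, e2] at h'
      rw [h']
      simp only [Fin.ext_iff]
    · rw [mem_parab.mp g.2 s t ht (by omega), if_neg]
      rintro rfl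
      exact hs ht
  · intro h
    refine Units.ext (Matrix.ext fun s t => ?_)
    rw [ul_apply, mem_fixer.mp h _ _ t.2, Units.val_one, Matrix.one_apply]
    simp only [(Fin.castLE_injective hc).eq_iff]

/-- The kernel of `ul` as a subgroup of `P^a_c` is `Q^a_c` pulled back. -/
theorem ker_ul_eq (hc : c ≤ a) : (ul (F := F) hc).ker = (fixer F a c).subgroupOf (parab F a c) := by
  ext g
  rw [MonoidHom.mem_ker, Subgroup.mem_subgroupOf, ul_eq_one_iff]

/-- **`|P^a_c| = |Q^a_c| · |GL_c(F)|`.** -/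
theorem card_parab (hc : c ≤ a) :
    Nat.card (parab F a c) = Nat.card (fixer F a c) * Nat.card (GL (Fin c) F) := by
  have h1 := Subgroup.card_eq_card_quotient_mul_card_subgroup ((ul (F := F) hc).ker)
  have h2 : Nat.card (parab F a c ⧸ (ul (F := F) hc).ker) = Nat.card (GL (Fin c) F) :=
    Nat.card_congr (QuotientGroup.quotientKerEquivOfSurjective _ (ul_surjective hc)).toEquiv
  have h3 : Nat.card ((ul (F := F) hc).ker) = Nat.card (fixer F a c) := by
    rw [ker_ul_eq]
    exact Nat.card_congr (Subgroup.subgroupOfEquivOfLe (fixer_le_parab (F := F) (a := a) (c := c))).toEquiv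
  rw [h1, h2, h3, mul_comm]

/-- `P^a_a = GL_a(F)`. -/
theorem parab_self_eq_top : parab F a a = ⊤ := by
  ext g
  simp only [mem_parab, Subgroup.mem_top, iff_true]
  intro s t ht hs
  omega

/-- `Q^a_a = 1`. -/
theorem fixer_self_eq_bot : fixer F a a = ⊥ := by
  ext g
  simp only [mem_fixer, Subgroup.mem_bot]
  constructor
  · intro h
    refine Units.ext (Matrix.ext fun s t => ?_)
    rw [h s t t.2, Units.val_one, Matrix.one_apply]
  · rintro rfl s t _
    rw [Units.val_one, Matrix.one_apply]

/-- `ul` on `P^a_a` is the inclusion. -/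
theorem ul_self (g : parab F a a) : ul le_rfl g = (g : GL (Fin a) F) := by
  refine Units.ext (Matrix.ext fun s t => ?_)
  rw [ul_apply]
  rfl

end ParabolicSubgroup
end Summit.MatrixMultiplication.MatrixMultiplication.Theorems.SubgroupIdentityDesigns.Negative
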